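import Summits.NavierStokesRegularity.NavierStokesRegularity.Theorems.ExtremiserTransienceTwoThirdsExcessMajorant
import Summits.NavierStokesRegularity.NavierStokesRegularity.Theorems.ExtremiserTransienceTwoThirdsAssemblyNormalised
import Summits.NavierStokesRegularity.NavierStokesRegularity.Theorems.ExtremiserTransienceTwoThirdsNormalise
import Summits.NavierStokesRegularity.NavierStokesRegularity.Theorems.ExtremiserTransienceTwoThirdsCellLattice
import HarnessLib

/-!
# Route `ExtremiserTransience`, crux `NearExtremalTransiencePerFlow` (stmt-NavierStokesRegularity-26567),
# LINE g10-1 «two_thirds» (ns-idea-10), stub S1a′ — THE NORMALISED TYPICAL SELECTION, PROVED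

`--supports stmt-NavierStokesRegularity-26567` (helper; prover seat ns-net-p2 g13).  `typicalSelectionNormalised_holds :
TypicalSelectionNormalised` (texts of record p726086) and hence `typicalSelectionLarge_holds : TypicalSelectionLarge` (S1a′, by the
affine zoom p726088).  Assembly: at the scale `4^i = ρ_i⁸` (`ρ_i = 2^{i/4} ≥ 2` for `i ≥ 4`) the averaged excess majorant
(`excess_majorant`, brick 2) feeds `thickUncovered_le_of_excess` (brick 3b) with `e₀ = C_e (t + 1/(tρ_i)) Z`, `t = θ^i`, `θ = 2^{-1/8}`
(so `t + 1/(tρ_i) = 2θ^i`); with the tolerance `δ_i = (1/2)/(i+1)` the bad (thick, uncovered) mass at scale `i` is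
`≤ 4096 Z [(ε/κ⋆)·76(i+1)² + θ^i (i+1)² (152 C_e/κ⋆ + 7)]` (`scale_bound`, `beta_le`); the series `Σ (i+1)² θ^i` converges, which gives
`i₁` (`tail_small`), and `ε₀ ∼ c₀ κ⋆/(m+1)³` handles the first part; `normalised_conclusion_of_uncovered_small` (brick 4b′) concludes.
HONEST FRAMING: closes the stub S1a′ of one line of the crux under its typed bricks; nothing about Navier–Stokes regularity itself is
proved; no summit is proved by a line. [folklore]
-/

noncomputable section

open scoped Topology InnerProductSpace RealInnerProductSpace ENNReal NNReal ContDiff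
open MeasureTheory Filter Set Metric
open Literature.Analysis.FluidPDE
open Summit.NavierStokesRegularity.NavierStokesRegularity.Theorems.DepletionLadder.KStar.HalfSpace
open Summit.NavierStokesRegularity.NavierStokesRegularity.Theorems.DepletionLadder.KStar.BangBang
open Summit.NavierStokesRegularity.NavierStokesRegularity.Theorems.NearExtremalTransiencePerFlow.LocalMaximiser

namespace Summit.NavierStokesRegularity.NavierStokesRegularity.Theorems.NearExtremalTransiencePerFlow.TwoThirds

-- the summit's namespace repeats the problem name by convention (D-0017)
set_option linter.dupNamespace false

/-! ## One scale -/

/-- **Bad mass at one scale**: bricks 2 + 3b at `s = ρ⁸` with the free parameter `t ∈ (0,1]`. [folklore] -/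
theorem scale_bound (A : ℕ → ℝ) (hA : ∀ j, 1 ≤ A j) (A_E θ₀ : ℝ) (hAE : 0 ≤ A_E) (hθ₀ : 0 < θ₀) :
    ∃ Ce : ℝ, 0 ≤ Ce ∧ ∀ (w : E3 → E3) (B ε ρ δ t : ℝ), IsAdm w 1 B → IsReg A w 1 → 0 < Zen w → 0 < Wpa w → lam w = 1 →
    0 ≤ ε → (kStar - ε) * Real.sqrt (Zen w) * Real.sqrt (Wpa w) ≤ Jst w → HasLinearGrowth A_E w → 2 ≤ ρ → 0 < δ → δ ≤ 1 / 2 →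
    0 < t → t ≤ 1 →
    ∫ x in {x | θ₀ ≤ ‖curl w x‖} ∩ {y | ∀ c, dist c y < ρ ^ 8 / 2 → ¬ IsGoodBall w c (ρ ^ 8) δ}, ‖curl w x‖ ^ 2 ≤
      4096 * ((ε / kStar) * (18 / δ ^ 2 + 2 / δ) * Zen w + (18 / δ ^ 2 + 2 / δ) / kStar * (Ce * (t + 1 / (t * ρ)) * Zen w) +
        δ⁻¹ * (Zen w + Wpa w) * (((ρ ^ 8 + (ρ ^ 8) ^ (7 / 8 : ℝ)) ^ 3 - (ρ ^ 8) ^ 3) / (8 * (ρ ^ 8) ^ 3))) := by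
  obtain ⟨Ce, hCe0, hE⟩ := excess_majorant A hA A_E θ₀ hAE hθ₀
  refine ⟨Ce, hCe0, fun w B ε ρ δ t hadm hreg hZ hW hlam hε hext hgr hρ hδ hδ1 ht ht1 => ?_⟩
  have hρ0 : 0 < ρ := by linarith
  have hs : 0 < ρ ^ 8 := by positivity
  obtain ⟨b, -, hbQ, hbΛ⟩ := exists_cellBasis hs
  obtain ⟨E, hE1, hE2⟩ := hE w B ρ t hadm hreg hZ hlam hgr hρ ht ht1 b hbQ hbΛ
  have he₀ : 0 ≤ Ce * (t + 1 / (t * ρ)) * Zen w := by positivity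
  exact thickUncovered_le_of_excess hadm hreg hZ hW hlam hε hext hs hδ hδ1 b hbQ hbΛ he₀ E hE1 hE2

/-! ## The scale parameters `ρ_i = 2^{i/4}`, `θ = 2^{-1/8}` -/

/-- `ρ_i ≥ 2` (`i ≥ 4`), `ρ_i⁸ = 4^i`, `0 < θ^i ≤ 1`, and `θ^i · θ^i · ρ_i = 1`. [folklore] -/
theorem scale_facts (i : ℕ) (hi : 4 ≤ i) :
    2 ≤ (2 : ℝ) ^ ((i : ℝ) / 4) ∧ ((2 : ℝ) ^ ((i : ℝ) / 4)) ^ 8 = (4 : ℝ) ^ i ∧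
    0 < ((2 : ℝ) ^ (-(1 / 8 : ℝ))) ^ i ∧ ((2 : ℝ) ^ (-(1 / 8 : ℝ))) ^ i ≤ 1 ∧
    ((2 : ℝ) ^ (-(1 / 8 : ℝ))) ^ i * (((2 : ℝ) ^ (-(1 / 8 : ℝ))) ^ i * (2 : ℝ) ^ ((i : ℝ) / 4)) = 1 := by
  have h2 : (0 : ℝ) < 2 := by norm_num
  refine ⟨?_, ?_, ?_, ?_, ?_⟩
  · have hi' : (4 : ℝ) ≤ i := by exact_mod_cast hi
    calc (2 : ℝ) = 2 ^ (1 : ℝ) := (Real.rpow_one 2).symm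
      _ ≤ 2 ^ ((i : ℝ) / 4) := Real.rpow_le_rpow_of_exponent_le (by norm_num) (by linarith)
  · rw [← Real.rpow_mul_natCast h2.le]
    have he : (i : ℝ) / 4 * ((8 : ℕ) : ℝ) = ((2 * i : ℕ) : ℝ) := by push_cast; ring
    rw [he, Real.rpow_natCast, pow_mul]
    norm_num
  · exact pow_pos (Real.rpow_pos_of_pos h2 _) i
  · exact pow_le_one₀ (Real.rpow_nonneg h2.le _) (Real.rpow_le_one_of_one_le_of_nonpos (by norm_num) (by norm_num))
  · rw [← Real.rpow_mul_natCast h2.le, ← Real.rpow_add h2, ← Real.rpow_add h2]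
    have he : -(1 / 8 : ℝ) * (i : ℕ) + (-(1 / 8 : ℝ) * (i : ℕ) + (i : ℝ) / 4) = 0 := by ring
    rw [he, Real.rpow_zero]

/-- The layer ratio at `s = ρ⁸`: `((ρ⁸ + (ρ⁸)^{7/8})³ − ρ²⁴)/(8ρ²⁴) ≤ 7/(8ρ)`. [folklore] -/
theorem layer_ratio_le {ρ : ℝ} (hρ : 2 ≤ ρ) :
    ((ρ ^ 8 + (ρ ^ 8) ^ (7 / 8 : ℝ)) ^ 3 - (ρ ^ 8) ^ 3) / (8 * (ρ ^ 8) ^ 3) ≤ 7 / 8 * (1 / ρ) := by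
  have hρ0 : 0 < ρ := by linarith
  have hr7 : (ρ ^ 8) ^ (7 / 8 : ℝ) = ρ ^ 7 := by
    rw [← Real.rpow_natCast ρ 8, ← Real.rpow_mul hρ0.le, show ((8 : ℕ) : ℝ) * (7 / 8 : ℝ) = ((7 : ℕ) : ℝ) by norm_num,
      Real.rpow_natCast]
  rw [hr7, div_le_iff₀ (by positivity)]
  have h1 : ρ ^ 22 ≤ ρ ^ 23 := pow_le_pow_right₀ (by linarith) (by norm_num)
  have h2 : ρ ^ 21 ≤ ρ ^ 23 := pow_le_pow_right₀ (by linarith) (by norm_num)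
  have hid : 7 / 8 * (1 / ρ) * (8 * (ρ ^ 8) ^ 3) = 7 * ρ ^ 23 := by
    rw [show (8 : ℝ) * (ρ ^ 8) ^ 3 = ρ * (8 * ρ ^ 23) by ring]
    field_simp
  rw [hid]
  nlinarith

/-! ## The per-scale majorization and the two sums -/

/-- The bad mass at scale `i` in closed form: `≤ 4096 Z [(ε/κ)·76(i+1)² + q (i+1)² (152 C_e/κ + 7)]` (`q = θ^i`). [folklore] -/
theorem beta_le {κ Ce ε Z W q ρ ℓ : ℝ} {i : ℕ} (hκ : 0 < κ) (hCe : 0 ≤ Ce) (hε : 0 ≤ ε) (hZ : 0 ≤ Z) (hW : W = Z)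
    (hq0 : 0 < q) (hrate : q + 1 / (q * ρ) = 2 * q) (hℓ : ℓ ≤ 7 / 8 * q) :
    4096 * ((ε / κ) * (18 / ((1 / 2) / ((i : ℝ) + 1)) ^ 2 + 2 / ((1 / 2) / ((i : ℝ) + 1))) * Z +
        (18 / ((1 / 2) / ((i : ℝ) + 1)) ^ 2 + 2 / ((1 / 2) / ((i : ℝ) + 1))) / κ * (Ce * (q + 1 / (q * ρ)) * Z) +
        ((1 / 2) / ((i : ℝ) + 1))⁻¹ * (Z + W) * ℓ) ≤
      4096 * Z * ((ε / κ) * (76 * ((i : ℝ) + 1) ^ 2)) + 4096 * (152 * Ce / κ + 7) * Z * (((i : ℝ) + 1) ^ 2 * q) := by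
  have hu : (1 : ℝ) ≤ (i : ℝ) + 1 := by have : (0 : ℝ) ≤ i := Nat.cast_nonneg i; linarith
  have hu0 : (0 : ℝ) < (i : ℝ) + 1 := by linarith
  have hδinv : ((1 / 2 : ℝ) / ((i : ℝ) + 1))⁻¹ = 2 * ((i : ℝ) + 1) := by rw [inv_div]; ring
  have h2δ : 2 / ((1 / 2 : ℝ) / ((i : ℝ) + 1)) = 4 * ((i : ℝ) + 1) := by rw [div_eq_mul_inv, hδinv]; ring
  have h18 : 18 / ((1 / 2 : ℝ) / ((i : ℝ) + 1)) ^ 2 = 72 * ((i : ℝ) + 1) ^ 2 := by rw [div_eq_mul_inv, ← inv_pow, hδinv]; ring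
  rw [h18, h2δ, hδinv, hrate, hW]
  have hu2 : (i : ℝ) + 1 ≤ ((i : ℝ) + 1) ^ 2 := by nlinarith
  have hκ' : 0 ≤ 1 / κ := by positivity
  -- the three groups
  have f1 : ε * (1 / κ) * (4 * ((i : ℝ) + 1)) * Z ≤ ε * (1 / κ) * (4 * ((i : ℝ) + 1) ^ 2) * Z :=
    mul_le_mul_of_nonneg_right (mul_le_mul_of_nonneg_left (by linarith) (by positivity)) hZ
  have f2 : 4 * ((i : ℝ) + 1) * (1 / κ) * (Ce * (2 * q) * Z) ≤ 4 * ((i : ℝ) + 1) ^ 2 * (1 / κ) * (Ce * (2 * q) * Z) :=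
    mul_le_mul_of_nonneg_right (mul_le_mul_of_nonneg_right (by linarith) hκ') (by positivity)
  have f3 : 2 * ((i : ℝ) + 1) * (Z + Z) * ℓ ≤ 2 * ((i : ℝ) + 1) * (Z + Z) * (7 / 8 * q) :=
    mul_le_mul_of_nonneg_left hℓ (by positivity)
  have f4 : 7 / 2 * ((i : ℝ) + 1) * q * Z ≤ 7 / 2 * ((i : ℝ) + 1) ^ 2 * q * Z :=
    mul_le_mul_of_nonneg_right (mul_le_mul_of_nonneg_right (by linarith) hq0.le) hZ
  have f5 : 0 ≤ ((i : ℝ) + 1) ^ 2 * q * Z := by positivity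
  have e1 : ε / κ = ε * (1 / κ) := by rw [div_eq_mul_one_div]
  have e2 : (72 * ((i : ℝ) + 1) ^ 2 + 4 * ((i : ℝ) + 1)) / κ = (72 * ((i : ℝ) + 1) ^ 2 + 4 * ((i : ℝ) + 1)) * (1 / κ) := by
    rw [div_eq_mul_one_div]
  have e3 : 152 * Ce / κ = 152 * Ce * (1 / κ) := by rw [div_eq_mul_one_div]
  rw [e1, e2, e3]
  linarith [f1, f2, f3, f4, f5]

/-- `Σ_{i₁ ≤ i < m} (i+1)² ≤ (m+1)³`. [folklore] -/
theorem sum_sq_le (i₁ m : ℕ) : ∑ i ∈ Finset.Ico i₁ m, ((i : ℝ) + 1) ^ 2 ≤ ((m : ℝ) + 1) ^ 3 := by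
  have hm0 : (0 : ℝ) ≤ m := Nat.cast_nonneg m
  calc ∑ i ∈ Finset.Ico i₁ m, ((i : ℝ) + 1) ^ 2 ≤ ∑ _i ∈ Finset.Ico i₁ m, ((m : ℝ) + 1) ^ 2 := by
        refine Finset.sum_le_sum fun i hi => ?_
        have him : i < m := (Finset.mem_Ico.1 hi).2
        have him' : (i : ℝ) < m := by exact_mod_cast him
        exact pow_le_pow_left₀ (by positivity) (by linarith) 2
    _ = ((Finset.Ico i₁ m).card : ℝ) * ((m : ℝ) + 1) ^ 2 := by rw [Finset.sum_const, nsmul_eq_mul]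
    _ ≤ ((m : ℝ) + 1) * ((m : ℝ) + 1) ^ 2 := by
        refine mul_le_mul_of_nonneg_right ?_ (by positivity)
        have hc : (Finset.Ico i₁ m).card ≤ m := by rw [Nat.card_Ico]; omega
        have hc' : ((Finset.Ico i₁ m).card : ℝ) ≤ m := by exact_mod_cast hc
        linarith
    _ = ((m : ℝ) + 1) ^ 3 := by ring

/-- **The tail of `Σ (i+1)² θ^i` is small** (`0 < θ < 1`). [folklore] -/
theorem tail_small {θ : ℝ} (hθ0 : 0 < θ) (hθ1 : θ < 1) {c : ℝ} (hc : 0 < c) :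
    ∃ N : ℕ, ∀ m, ∑ i ∈ Finset.Ico N m, ((i : ℝ) + 1) ^ 2 * θ ^ i < c := by
  have hθn : ‖θ‖ < 1 := by rw [Real.norm_eq_abs, abs_of_nonneg hθ0.le]; exact hθ1
  have h2 := summable_pow_mul_geometric_of_norm_lt_one 2 hθn
  have h3 : Summable (fun i : ℕ => ((i + 1 : ℕ) : ℝ) ^ 2 * θ ^ (i + 1)) := (summable_nat_add_iff 1).2 h2
  have hg : Summable (fun i : ℕ => ((i : ℝ) + 1) ^ 2 * θ ^ i) := by
    refine (h3.mul_left θ⁻¹).congr fun i => ?_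
    push_cast
    rw [pow_succ θ i, mul_comm (θ ^ i) θ, mul_left_comm, inv_mul_cancel_left₀ hθ0.ne']
  have hg0 : ∀ i, 0 ≤ ((i : ℝ) + 1) ^ 2 * θ ^ i := fun i => by positivity
  have ht := hg.tendsto_sum_tsum_nat
  obtain ⟨N, hN⟩ := Metric.tendsto_atTop.1 ht (c / 2) (by positivity)
  refine ⟨N, fun m => ?_⟩
  by_cases hm : N ≤ m
  · rw [Finset.sum_Ico_eq_sub _ hm]
    have h1 := hN m hm
    have h2' := hN N le_rfl
    rw [Real.dist_eq] at h1 h2'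
    have a1 := abs_lt.1 h1
    have a2 := abs_lt.1 h2'
    linarith
  · rw [Finset.Ico_eq_empty_of_le (by omega), Finset.sum_empty]
    exact hc

/-! ## S1a′ -/

/-- **S1a′, NORMALISED FORM** (texts of record p726086): the typical selection of a thick point with good balls at all scales
`i₁ ≤ i < m`, for fields of height `1`, Taylor length `1`, linear local energy growth and small `κ⋆`-deficit. [folklore] -/
theorem typicalSelectionNormalised_holds : TypicalSelectionNormalised := by
  intro A hA A_E hAE
  obtain ⟨θ₀, c₀, hθ₀, hc₀, hmain⟩ := normalised_conclusion_of_uncovered_small A hA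
  obtain ⟨Ce, hCe0, hscale⟩ := scale_bound A hA A_E θ₀ hAE.le hθ₀
  have hκ : 0 < kStar := kStar_pos
  -- the ratio `θ = 2^{-1/8}`
  obtain ⟨θ, hθ⟩ : ∃ θ : ℝ, θ = (2 : ℝ) ^ (-(1 / 8 : ℝ)) := ⟨_, rfl⟩
  have hθ0 : 0 < θ := by rw [hθ]; exact Real.rpow_pos_of_pos (by norm_num) _
  have hθ1 : θ < 1 := by rw [hθ]; exact Real.rpow_lt_one_of_one_lt_of_neg (by norm_num) (by norm_num)
  -- the coefficient of the geometric part and the tail index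
  obtain ⟨M, hM⟩ : ∃ M : ℝ, M = 4096 * (152 * Ce / kStar + 7) := ⟨_, rfl⟩
  have hM0 : 0 < M := by rw [hM]; positivity
  obtain ⟨N, hN⟩ := tail_small hθ0 hθ1 (c := c₀ / (4 * M)) (by positivity)
  refine ⟨θ₀, 1 / 2, hθ₀, by norm_num, max N 4, fun R η m hR hη => ?_⟩
  obtain ⟨ε₁, hε₁, hmain'⟩ := hmain R η hR hη
  obtain ⟨ε₂, hε₂⟩ : ∃ ε₂ : ℝ, ε₂ = c₀ * kStar / (4 * 4096 * 76 * ((m : ℝ) + 1) ^ 3) := ⟨_, rfl⟩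
  have hε₂0 : 0 < ε₂ := by rw [hε₂]; positivity
  refine ⟨min ε₁ ε₂, lt_min hε₁ hε₂0, fun w B ε hadm hreg hZ hW hlam hε0 hε hext hgr => ?_⟩
  have hgr' : HasLinearGrowth A_E w := fun x r hr => hgr x r hr
  have hWZ : Wpa w = Zen w := by
    have h : Real.sqrt (Zen w / Wpa w) = 1 := hlam
    have h2' : Zen w / Wpa w = 1 := Real.sqrt_eq_one.1 h
    field_simp at h2'
    linarith
  -- the per-scale bound
  have hβ : ∀ i : ℕ, max N 4 ≤ i → i < m →
      ∫ x in {x | θ₀ ≤ ‖curl w x‖} ∩ {y | ∀ c, dist c y < (4 : ℝ) ^ i / 2 →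
        c ∉ (fun j : ℕ => {c : E3 | IsGoodBall w c ((4 : ℝ) ^ j) ((1 / 2) / ((j : ℝ) + 1))}) i}, ‖curl w x‖ ^ 2 ≤
      4096 * Zen w * ((ε / kStar) * (76 * ((i : ℝ) + 1) ^ 2)) + M * Zen w * (((i : ℝ) + 1) ^ 2 * θ ^ i) := by
    intro i hi _
    have hi4 : 4 ≤ i := le_trans (le_max_right _ _) hi
    obtain ⟨hρ2, hρ8, hq0, hq1, hkey⟩ := scale_facts i hi4
    rw [← hθ] at hq0 hq1 hkey
    have hρ0 : 0 < (2 : ℝ) ^ ((i : ℝ) / 4) := by linarith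
    have hδ0 : 0 < (1 / 2 : ℝ) / ((i : ℝ) + 1) := by positivity
    have hδ1 : (1 / 2 : ℝ) / ((i : ℝ) + 1) ≤ 1 / 2 := by
      rw [div_le_iff₀ (by positivity)]
      have : (0 : ℝ) ≤ i := Nat.cast_nonneg i
      nlinarith
    have hrate : θ ^ i + 1 / (θ ^ i * (2 : ℝ) ^ ((i : ℝ) / 4)) = 2 * θ ^ i := by
      rw [← eq_one_div_of_mul_eq_one_left hkey]; ring
    have h1ρ : 1 / (2 : ℝ) ^ ((i : ℝ) / 4) ≤ θ ^ i := by
      have h : 1 / (2 : ℝ) ^ ((i : ℝ) / 4) = θ ^ i * θ ^ i := by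
        rw [div_eq_iff hρ0.ne', ← hkey]; ring
      rw [h]
      calc θ ^ i * θ ^ i ≤ θ ^ i * 1 := mul_le_mul_of_nonneg_left hq1 hq0.le
        _ = θ ^ i := mul_one _
    have hℓ := (layer_ratio_le hρ2).trans (mul_le_mul_of_nonneg_left h1ρ (by norm_num))
    have hb := hscale w B ε ((2 : ℝ) ^ ((i : ℝ) / 4)) ((1 / 2 : ℝ) / ((i : ℝ) + 1)) (θ ^ i) hadm hreg hZ hW hlam hε0 hext hgr'
      hρ2 hδ0 hδ1 hq0 hq1
    have hb2 := hb.trans (beta_le (i := i) hκ hCe0 hε0 hZ.le hWZ hq0 hrate hℓ)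
    rw [← hM, hρ8] at hb2
    exact hb2
  -- the sum of the per-scale bounds
  have hsum : (∑ i ∈ Finset.Ico (max N 4) m,
      (4096 * Zen w * ((ε / kStar) * (76 * ((i : ℝ) + 1) ^ 2)) + M * Zen w * (((i : ℝ) + 1) ^ 2 * θ ^ i))) < c₀ * Zen w := by
    simp only [Finset.sum_add_distrib, ← Finset.mul_sum]
    have hS1 := sum_sq_le (max N 4) m
    have hS2 : ∑ i ∈ Finset.Ico (max N 4) m, ((i : ℝ) + 1) ^ 2 * θ ^ i < c₀ / (4 * M) := by
      refine lt_of_le_of_lt (Finset.sum_le_sum_of_subset_of_nonneg (Finset.Ico_subset_Ico (le_max_left N 4) le_rfl)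
        fun i _ _ => by positivity) (hN m)
    have hεκ : ε * (4 * 4096 * 76 * ((m : ℝ) + 1) ^ 3) ≤ c₀ * kStar :=
      (le_div_iff₀ (by positivity)).1 ((hε.trans (min_le_right _ _)).trans (le_of_eq hε₂))
    have hA1 : 4096 * Zen w * ((ε / kStar) * (76 * ((m : ℝ) + 1) ^ 3)) ≤ c₀ * Zen w / 4 := by
      have hid : 4096 * Zen w * ((ε / kStar) * (76 * ((m : ℝ) + 1) ^ 3)) = Zen w / kStar / 4 * (ε * (4 * 4096 * 76 * ((m : ℝ) + 1) ^ 3)) := by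
        field_simp
      rw [hid]
      calc Zen w / kStar / 4 * (ε * (4 * 4096 * 76 * ((m : ℝ) + 1) ^ 3)) ≤ Zen w / kStar / 4 * (c₀ * kStar) :=
            mul_le_mul_of_nonneg_left hεκ (by positivity)
        _ = c₀ * Zen w / 4 := by field_simp
    have hA1' : 4096 * Zen w * ((ε / kStar) * (76 * ∑ i ∈ Finset.Ico (max N 4) m, ((i : ℝ) + 1) ^ 2)) ≤ c₀ * Zen w / 4 := by
      refine le_trans ?_ hA1
      have hεk : 0 ≤ ε / kStar := by positivity
      have := mul_le_mul_of_nonneg_left (mul_le_mul_of_nonneg_left hS1 (by norm_num : (0 : ℝ) ≤ 76)) hεk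
      exact mul_le_mul_of_nonneg_left this (by positivity)
    have hA2 : M * Zen w * ∑ i ∈ Finset.Ico (max N 4) m, ((i : ℝ) + 1) ^ 2 * θ ^ i ≤ M * Zen w * (c₀ / (4 * M)) :=
      mul_le_mul_of_nonneg_left hS2.le (by positivity)
    have hA2' : M * Zen w * (c₀ / (4 * M)) = c₀ * Zen w / 4 := by field_simp
    have hcZ : 0 < c₀ * Zen w := mul_pos hc₀ hZ
    linarith [hA1', hA2, hA2', hcZ]
  exact hmain' w B ε hadm hreg hZ hW hlam hε0 (hε.trans (min_le_left _ _)) hext (max N 4) m (1 / 2)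
    (fun j : ℕ => {c : E3 | IsGoodBall w c ((4 : ℝ) ^ j) ((1 / 2) / ((j : ℝ) + 1))})
    (fun i => 4096 * Zen w * ((ε / kStar) * (76 * ((i : ℝ) + 1) ^ 2)) + M * Zen w * (((i : ℝ) + 1) ^ 2 * θ ^ i))
    (fun i _ _ c hc => ⟨(4 : ℝ) ^ i, le_rfl, by linarith [pow_pos (by norm_num : (0 : ℝ) < 4) i], hc⟩) hβ hsum

/-- **S1a′** (`TypicalSelectionLarge`, texts of record p725367): from the normalised form by the affine zoom (p726088). [folklore] -/
theorem typicalSelectionLarge_holds : TypicalSelectionLarge :=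
  typicalSelectionLarge_of_normalised typicalSelectionNormalised_holds

end Summit.NavierStokesRegularity.NavierStokesRegularity.Theorems.NearExtremalTransiencePerFlow.TwoThirds

end
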